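import Summits.CriticalPhenomena.PercolationContinuityZ3.Theorems.PercNearOneGluingNoHeavyLowerTailSunflowerMultiPetalUpperOnePetal
import Summits.CriticalPhenomena.PercolationContinuityZ3.Theorems.PercNearOneGluingNoHeavyLowerTailSunflowerMultiPetalSlackMonotone
import HarnessLib
import HarnessLib.Audit

/-!
# `NoHeavyLowerTail` (crux stmt-CriticalPhenomena-4575), abstract sunflower cubic, `k` petals: the QUANTITATIVE one-point reduction at a coordinate whose
# UPPER SECTION IS NEVER BOTTOM (`b₀ + b₃ ≤ 3 b₁`), every number of petals

Support file (seat `prim-l12-p2` gen 32; `--supports stmt-CriticalPhenomena-4575`; multi-petal port of prim-ineq-gen-2's `k = 3`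
`Sunflower.ZP_add_con_le_of_upper_ne_zero` (`…SunflowerOnePointCertificatesB`), on the template of `…SunflowerMultiPetalUpperOnePetal` (`chart4`) and its sibling
`…SunflowerMultiPetalInert` (this gen: bottom-inert and kernel-inert; the pair-petal chart is re-proved privately here because that module is not yet built on the farm)).
No `sorry`; nothing is asserted about the crux.  Memo: run/shared/lean/prim/prim-l12/prim-l12-p2/FINDING-g32-FLIP-SLOT-AND-SATURATED-PRIMES.md §4.5.

THEOREM (`MSunflower.nested_add_nested_insert_le_of_upper_ne_zero`).  `F : MSunflower k α`, `e ∉ W`, and `lab (insert e X) ≠ 0` for every `X ⊆ W` (e.g. `lab {e} ≠ 0`: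
`MSunflower.nested_add_nested_insert_le_of_lab_singleton_ne_zero`).  Then
  `nested W (s6K ∘ lab) + nested W (s6K ∘ lab ∘ insert e) ≤ nested (insert e W) (s6K ∘ lab)`,
i.e. DELETION plus CONTRACTION at `e` are dominated by the full cube — the quantitative form of (MZₖ) at a non-bottom singleton
(`ZKW_le_ZKW_insert_of_lab_singleton_ne_zero`, p343107, which is the same without the contraction term).  At the top cube:
`ZKW (univ ∖ e) + (contraction functional on univ ∖ e) ≤ ZK` (`MSunflower.ZKW_erase_add_le_ZK_of_lab_singleton_ne_zero`).
POINTWISE (`nbIneqK`, ×3-scaled; `decide` on `Fin 6` codes, transported by the pair-petal chart): with `x₀ = lab X ≤ x₁ = lab (insert e X)`, `x₁ ≠ 0`,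
  `3 s6K x₀y₀z₀ + 3 s6K x₁y₁z₁ + Σ_blocks ( 3[x₁ = ⊤]·kkK y₀z₀ + (3[x₀ = 0, x₁ petal] + [x₀ petal, x₁ = x₀])·kkK y₁z₁ ) ≤ 3 (s6K x₁y₀z₀ + s6K x₀y₁z₀ + s6K x₀y₀z₁)`;
the weighted sums are (offset) antipodal-Gladkov sums `≥ 0`.  (The unit-weight simplification without the `[x₀ petal, x₁ = x₀]` term is FALSE pointwise — 6 violations
at `k = 3`.)
-/

namespace Summit.CriticalPhenomena.PercolationContinuityZ3.Theorems.SunflowerPartition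

open Finset

variable {α : Type*} [DecidableEq α]

/-! ## Weights and codes -/

/-- Lower weight `3·[x₁ = ⊤]`. [this work] -/
def nbWtLoK (k : ℕ) (x1 : Fin (k + 2)) : ℤ := if x1 = Fin.last (k + 1) then 3 else 0

/-- Upper weight `3·[x₀ = 0 ∧ x₁ petal] + [x₀ petal ∧ x₁ = x₀]`. [this work] -/
def nbWtUpK (k : ℕ) (x0 x1 : Fin (k + 2)) : ℤ :=
  (if x0 = 0 ∧ x1 ≠ Fin.last (k + 1) ∧ x1 ≠ 0 then 3 else 0) + (if x0 ≠ Fin.last (k + 1) ∧ x0 ≠ 0 ∧ x0 = x1 then 1 else 0)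

/-- `nbWtLoK ≥ 0`. [this work] -/
theorem nbWtLoK_nonneg (k : ℕ) (x1 : Fin (k + 2)) : 0 ≤ nbWtLoK k x1 := by
  unfold nbWtLoK; split_ifs <;> norm_num

/-- `nbWtUpK ≥ 0`. [this work] -/
theorem nbWtUpK_nonneg (k : ℕ) (x0 x1 : Fin (k + 2)) : 0 ≤ nbWtUpK k x0 x1 := by
  unfold nbWtUpK; split_ifs <;> norm_num

/-- Transport of `nbWtLoK`. [this work] -/
theorem nbWtLoK_congr {k k' : ℕ} {x1 : Fin (k + 2)} {x1' : Fin (k' + 2)} (h1t : x1 = Fin.last (k + 1) ↔ x1' = Fin.last (k' + 1)) :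
    nbWtLoK k x1 = nbWtLoK k' x1' := by
  unfold nbWtLoK; exact if_congr h1t rfl rfl

/-- Transport of `nbWtUpK`. [this work] -/
theorem nbWtUpK_congr {k k' : ℕ} {x0 x1 : Fin (k + 2)} {x0' x1' : Fin (k' + 2)}
    (h0t : x0 = Fin.last (k + 1) ↔ x0' = Fin.last (k' + 1)) (h00 : x0 = 0 ↔ x0' = 0)
    (h1t : x1 = Fin.last (k + 1) ↔ x1' = Fin.last (k' + 1)) (h10 : x1 = 0 ↔ x1' = 0) (h01 : x0 = x1 ↔ x0' = x1') :
    nbWtUpK k x0 x1 = nbWtUpK k' x0' x1' := by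
  unfold nbWtUpK
  rw [if_congr (and_congr h00 (and_congr (not_congr h1t) (not_congr h10))) (Eq.refl (3 : ℤ)) (Eq.refl (0 : ℤ)),
    if_congr (and_congr (not_congr h0t) (and_congr (not_congr h00) h01)) (Eq.refl (1 : ℤ)) (Eq.refl (0 : ℤ))]

/-- Upper-never-bottom code on `Fin 6`: `x0 ≤ x1` in `M_4` and `x1 ≠ 0`. [this work] -/
def nbCodeK6 (x0 x1 : Fin 6) : Bool := (x0 == x1 || x0 == 0 || x1 == 5) && !(x1 == 0)

/-- From the propositional conditions to the code. [this work] -/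
theorem nbCodeK6_of : ∀ a b : Fin 6, (a = b ∨ a = 0 ∨ b = 5) → b ≠ 0 → nbCodeK6 a b = true := by decide

/-- The upper-never-bottom pointwise inequality on `Fin 6` codes (`decide`). [this work] -/
theorem nbIneq6 : ∀ x0 x1 y0 y1 z0 z1 : Fin 6, nbCodeK6 x0 x1 = true → nbCodeK6 y0 y1 = true → nbCodeK6 z0 z1 = true →
    3 * s6K 4 x0 y0 z0 + 3 * s6K 4 x1 y1 z1
      + nbWtLoK 4 x1 * kkK 4 y0 z0 + nbWtLoK 4 y1 * kkK 4 x0 z0 + nbWtLoK 4 z1 * kkK 4 x0 y0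
      + nbWtUpK 4 x0 x1 * kkK 4 y1 z1 + nbWtUpK 4 y0 y1 * kkK 4 x1 z1 + nbWtUpK 4 z0 z1 * kkK 4 x1 y1
      ≤ 3 * s6K 4 x1 y0 z0 + 3 * s6K 4 x0 y1 z0 + 3 * s6K 4 x0 y0 z1 := by
  decide

section Chart

variable {k : ℕ} (x0 x1 y0 y1 z0 z1 : Fin (k + 2))

/-- The pair-petal chart (private copy of `chart_pairs` of `…MultiPetalInert`): top/bottom detection and faithfulness on the six labels of three
comparable pairs. [this work] -/
private theorem chart_pairs' (hx : x0 = x1 ∨ x0 = 0 ∨ x1 = Fin.last (k + 1)) (hy : y0 = y1 ∨ y0 = 0 ∨ y1 = Fin.last (k + 1))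
    (hz : z0 = z1 ∨ z0 = 0 ∨ z1 = Fin.last (k + 1)) :
    ∃ c : Fin (k + 2) → Fin 6,
      (∀ w, w = Fin.last (k + 1) ↔ c w = Fin.last (4 + 1)) ∧ (∀ w, w = 0 ↔ c w = 0) ∧
      (∀ w', x0 = w' ↔ c x0 = c w') ∧ (∀ w', x1 = w' ↔ c x1 = c w') ∧ (∀ w', y0 = w' ↔ c y0 = c w') ∧
      (∀ w', y1 = w' ↔ c y1 = c w') ∧ (∀ w', z0 = w' ↔ c z0 = c w') ∧ (∀ w', z1 = w' ↔ c z1 = c w') := by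
  -- pair petals: the lower label if it is a petal, else the upper label
  have pp : ∀ {u v : Fin (k + 2)}, (u = v ∨ u = 0 ∨ v = Fin.last (k + 1)) → ∃ p : Fin (k + 2),
      (u = Fin.last (k + 1) ∨ u = 0 ∨ u = p) ∧ (v = Fin.last (k + 1) ∨ v = 0 ∨ v = p) := by
    intro u v hle
    by_cases h : u = 0 ∨ u = Fin.last (k + 1)
    · refine ⟨v, ?_, Or.inr (Or.inr rfl)⟩
      rcases h with h | h
      · exact Or.inr (Or.inl h)
      · exact Or.inl h
    · refine ⟨u, Or.inr (Or.inr rfl), ?_⟩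
      rcases hle with h1 | h1 | h1
      · exact Or.inr (Or.inr h1.symm)
      · exact (h (Or.inl h1)).elim
      · exact Or.inl h1
  obtain ⟨a, mx0, mx1⟩ := pp hx
  obtain ⟨b, my0, my1⟩ := pp hy
  obtain ⟨d, mz0, mz1⟩ := pp hz
  have e5 : (5 : Fin 6) = Fin.last (4 + 1) := rfl
  refine ⟨chart4 k a b d, fun w => e5 ▸ (chart4_eq_five_iff k a b d w).symm, fun w => (chart4_eq_zero_iff k a b d w).symm, ?_⟩
  have nv : ∀ {u : Fin (k + 2)}, (u = Fin.last (k + 1) ∨ u = 0 ∨ u = a ∨ u = b ∨ u = d) →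
      (u ≠ Fin.last (k + 1) → u ≠ 0 → u ≠ a → u ≠ b → u ≠ d → False) := by
    intro u hu h1 h2 h3 h4 h5
    rcases hu with h | h | h | h | h
    exacts [h1 h, h2 h, h3 h, h4 h, h5 h]
  have E : ∀ {w : Fin (k + 2)}, (w = Fin.last (k + 1) ∨ w = 0 ∨ w = a ∨ w = b ∨ w = d) →
      ∀ w', (w = w' ↔ chart4 k a b d w = chart4 k a b d w') :=
    fun hw _ => chart4_eq_iff k a b d (fun t h0 ha hb hd _ _ _ _ _ => (nv hw t h0 ha hb hd).elim)
  have iA : ∀ {u : Fin (k + 2)}, (u = Fin.last (k + 1) ∨ u = 0 ∨ u = a) → (u = Fin.last (k + 1) ∨ u = 0 ∨ u = a ∨ u = b ∨ u = d) :=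
    fun h => h.elim Or.inl fun h => h.elim (fun h => Or.inr (Or.inl h)) fun h => Or.inr (Or.inr (Or.inl h))
  have iB : ∀ {u : Fin (k + 2)}, (u = Fin.last (k + 1) ∨ u = 0 ∨ u = b) → (u = Fin.last (k + 1) ∨ u = 0 ∨ u = a ∨ u = b ∨ u = d) :=
    fun h => h.elim Or.inl fun h => h.elim (fun h => Or.inr (Or.inl h)) fun h => Or.inr (Or.inr (Or.inr (Or.inl h)))
  have iD : ∀ {u : Fin (k + 2)}, (u = Fin.last (k + 1) ∨ u = 0 ∨ u = d) → (u = Fin.last (k + 1) ∨ u = 0 ∨ u = a ∨ u = b ∨ u = d) :=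
    fun h => h.elim Or.inl fun h => h.elim (fun h => Or.inr (Or.inl h)) fun h => Or.inr (Or.inr (Or.inr (Or.inr h)))
  exact ⟨E (iA mx0), E (iA mx1), E (iB my0), E (iB my1), E (iD mz0), E (iD mz1)⟩

end Chart

/-- **The upper-never-bottom pointwise inequality for every `k`** (×3-scaled). [this work] -/
theorem nbIneqK {k : ℕ} (x0 x1 y0 y1 z0 z1 : Fin (k + 2))
    (hx : x0 = x1 ∨ x0 = 0 ∨ x1 = Fin.last (k + 1)) (hy : y0 = y1 ∨ y0 = 0 ∨ y1 = Fin.last (k + 1))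
    (hz : z0 = z1 ∨ z0 = 0 ∨ z1 = Fin.last (k + 1)) (hx' : x1 ≠ 0) (hy' : y1 ≠ 0) (hz' : z1 ≠ 0) :
    3 * s6K k x0 y0 z0 + 3 * s6K k x1 y1 z1
      + nbWtLoK k x1 * kkK k y0 z0 + nbWtLoK k y1 * kkK k x0 z0 + nbWtLoK k z1 * kkK k x0 y0
      + nbWtUpK k x0 x1 * kkK k y1 z1 + nbWtUpK k y0 y1 * kkK k x1 z1 + nbWtUpK k z0 z1 * kkK k x1 y1
      ≤ 3 * s6K k x1 y0 z0 + 3 * s6K k x0 y1 z0 + 3 * s6K k x0 y0 z1 := by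
  obtain ⟨c, T, Zr, Ex0, Ex1, Ey0, Ey1, Ez0, Ez1⟩ := chart_pairs' x0 x1 y0 y1 z0 z1 hx hy hz
  rw [s6K_congr (T x0) (Zr x0) (T y0) (Zr y0) (T z0) (Zr z0) (Ex0 y0) (Ey0 z0) (Ex0 z0),
    s6K_congr (T x1) (Zr x1) (T y1) (Zr y1) (T z1) (Zr z1) (Ex1 y1) (Ey1 z1) (Ex1 z1),
    nbWtLoK_congr (T x1), kkK_congr (T y0) (Zr y0) (T z0) (Zr z0) (Ey0 z0),
    nbWtLoK_congr (T y1), kkK_congr (T x0) (Zr x0) (T z0) (Zr z0) (Ex0 z0),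
    nbWtLoK_congr (T z1), kkK_congr (T x0) (Zr x0) (T y0) (Zr y0) (Ex0 y0),
    nbWtUpK_congr (T x0) (Zr x0) (T x1) (Zr x1) (Ex0 x1), kkK_congr (T y1) (Zr y1) (T z1) (Zr z1) (Ey1 z1),
    nbWtUpK_congr (T y0) (Zr y0) (T y1) (Zr y1) (Ey0 y1), kkK_congr (T x1) (Zr x1) (T z1) (Zr z1) (Ex1 z1),
    nbWtUpK_congr (T z0) (Zr z0) (T z1) (Zr z1) (Ez0 z1), kkK_congr (T x1) (Zr x1) (T y1) (Zr y1) (Ex1 y1),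
    s6K_congr (T x1) (Zr x1) (T y0) (Zr y0) (T z0) (Zr z0) (Ex1 y0) (Ey0 z0) (Ex1 z0),
    s6K_congr (T x0) (Zr x0) (T y1) (Zr y1) (T z0) (Zr z0) (Ex0 y1) (Ey1 z0) (Ex0 z0),
    s6K_congr (T x0) (Zr x0) (T y0) (Zr y0) (T z1) (Zr z1) (Ex0 y0) (Ey0 z1) (Ex0 z1)]
  have e5 : (5 : Fin 6) = Fin.last (4 + 1) := rfl
  have cd : ∀ {u v : Fin (k + 2)}, (∀ w', u = w' ↔ c u = c w') → (u = v ∨ u = 0 ∨ v = Fin.last (k + 1)) → v ≠ 0 →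
      nbCodeK6 (c u) (c v) = true := by
    intro u v Eu h h'
    refine nbCodeK6_of _ _ ?_ fun hv => h' ((Zr v).2 hv)
    rcases h with h | h | h
    · exact Or.inl ((Eu v).1 h)
    · exact Or.inr (Or.inl ((Zr u).1 h))
    · exact Or.inr (Or.inr (e5 ▸ (T v).1 h))
  exact nbIneq6 _ _ _ _ _ _ (cd Ex0 hx hx') (cd Ey0 hy hy') (cd Ez0 hz hz')

/-! ## The nested inequality and the top cube -/

namespace MSunflower

variable {k : ℕ} (F : MSunflower k α)

/-- Offset antipodal Gladkov at `e` (private copy of `antipodal_gladkov_insert` of `…MultiPetalInert`). [this work] -/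
private theorem antipodal_gladkov_insert' (V : Finset α) (e : α) :
    0 ≤ ∑ S ∈ V.powerset, kkK k (F.lab (insert e S)) (F.lab (insert e (V \ S))) := by
  have h := F.pslack_nonneg V {e}
  unfold pslack at h
  simpa only [insert_eq] using h

/-- Lower weighted spectator sums are antipodal-Gladkov sums, hence nonnegative. [this work] -/
theorem nested_nbWtLoK_kkK_nonneg (W : Finset α) (e : α) :
    0 ≤ nested W (fun X Y Z => nbWtLoK k (F.lab (insert e X)) * kkK k (F.lab Y) (F.lab Z)) := by
  unfold nested
  refine sum_nonneg fun X _ => ?_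
  rw [← mul_sum]
  exact mul_nonneg (nbWtLoK_nonneg k _) (F.antipodal_gladkov (W \ X))

/-- Upper weighted spectator sums are offset antipodal-Gladkov sums, hence nonnegative. [this work] -/
theorem nested_nbWtUpK_kkK_nonneg (W : Finset α) (e : α) :
    0 ≤ nested W (fun X Y Z => nbWtUpK k (F.lab X) (F.lab (insert e X)) * kkK k (F.lab (insert e Y)) (F.lab (insert e Z))) := by
  unfold nested
  refine sum_nonneg fun X _ => ?_
  rw [← mul_sum]
  exact mul_nonneg (nbWtUpK_nonneg k _ _) (F.antipodal_gladkov_insert' (W \ X) e)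

/-- Scaling a nested sum. [this work] -/
theorem mul_nested (W : Finset α) (c : ℤ) (G : Finset α → Finset α → Finset α → ℤ) :
    c * nested W G = nested W (fun X Y Z => c * G X Y Z) := by
  unfold nested
  rw [mul_sum]
  refine sum_congr rfl fun X _ => ?_
  rw [mul_sum]

/-- **UPPER SECTION NEVER BOTTOM, every `k`** (this work): if `e ∉ W` and `lab (insert e X) ≠ 0` for all `X ⊆ W`, then
`nested W (s6K ∘ lab) + nested W (s6K ∘ lab ∘ insert e) ≤ nested (insert e W) (s6K ∘ lab)` (`b₀ + b₃ ≤ 3b₁`). [this work] -/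
theorem nested_add_nested_insert_le_of_upper_ne_zero (W : Finset α) (e : α) (he : e ∉ W)
    (hnb : ∀ X ⊆ W, F.lab (insert e X) ≠ 0) :
    nested W (fun X Y Z => s6K k (F.lab X) (F.lab Y) (F.lab Z))
      + nested W (fun X Y Z => s6K k (F.lab (insert e X)) (F.lab (insert e Y)) (F.lab (insert e Z)))
      ≤ nested (insert e W) (fun X Y Z => s6K k (F.lab X) (F.lab Y) (F.lab Z)) := by
  rw [nested_insert_split W e he]
  have h1 := F.nested_nbWtLoK_kkK_nonneg W e
  have h2 : 0 ≤ nested W (fun X Y Z => nbWtLoK k (F.lab (insert e Y)) * kkK k (F.lab X) (F.lab Z)) := by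
    rw [nested_swap12]; exact F.nested_nbWtLoK_kkK_nonneg W e
  have h3 : 0 ≤ nested W (fun X Y Z => nbWtLoK k (F.lab (insert e Z)) * kkK k (F.lab X) (F.lab Y)) := by
    rw [nested_swap23, nested_swap12]; exact F.nested_nbWtLoK_kkK_nonneg W e
  have h4 := F.nested_nbWtUpK_kkK_nonneg W e
  have h5 : 0 ≤ nested W (fun X Y Z => nbWtUpK k (F.lab Y) (F.lab (insert e Y)) * kkK k (F.lab (insert e X)) (F.lab (insert e Z))) := by
    rw [nested_swap12]; exact F.nested_nbWtUpK_kkK_nonneg W e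
  have h6 : 0 ≤ nested W (fun X Y Z => nbWtUpK k (F.lab Z) (F.lab (insert e Z)) * kkK k (F.lab (insert e X)) (F.lab (insert e Y))) := by
    rw [nested_swap23, nested_swap12]; exact F.nested_nbWtUpK_kkK_nonneg W e
  have s0 := mul_nested W 3 (fun X Y Z => s6K k (F.lab X) (F.lab Y) (F.lab Z))
  have s3 := mul_nested W 3 (fun X Y Z => s6K k (F.lab (insert e X)) (F.lab (insert e Y)) (F.lab (insert e Z)))
  have u1 := mul_nested W 3 (fun X S T => s6K k (F.lab (insert e X)) (F.lab S) (F.lab T))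
  have u2 := mul_nested W 3 (fun X S T => s6K k (F.lab X) (F.lab (insert e S)) (F.lab T))
  have u3 := mul_nested W 3 (fun X S T => s6K k (F.lab X) (F.lab S) (F.lab (insert e T)))
  have key : nested W (fun X Y Z => 3 * s6K k (F.lab X) (F.lab Y) (F.lab Z))
      + nested W (fun X Y Z => 3 * s6K k (F.lab (insert e X)) (F.lab (insert e Y)) (F.lab (insert e Z)))
      + nested W (fun X Y Z => nbWtLoK k (F.lab (insert e X)) * kkK k (F.lab Y) (F.lab Z))
      + nested W (fun X Y Z => nbWtLoK k (F.lab (insert e Y)) * kkK k (F.lab X) (F.lab Z))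
      + nested W (fun X Y Z => nbWtLoK k (F.lab (insert e Z)) * kkK k (F.lab X) (F.lab Y))
      + nested W (fun X Y Z => nbWtUpK k (F.lab X) (F.lab (insert e X)) * kkK k (F.lab (insert e Y)) (F.lab (insert e Z)))
      + nested W (fun X Y Z => nbWtUpK k (F.lab Y) (F.lab (insert e Y)) * kkK k (F.lab (insert e X)) (F.lab (insert e Z)))
      + nested W (fun X Y Z => nbWtUpK k (F.lab Z) (F.lab (insert e Z)) * kkK k (F.lab (insert e X)) (F.lab (insert e Y)))
      ≤ nested W (fun X S T => 3 * s6K k (F.lab (insert e X)) (F.lab S) (F.lab T))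
        + nested W (fun X S T => 3 * s6K k (F.lab X) (F.lab (insert e S)) (F.lab T))
        + nested W (fun X S T => 3 * s6K k (F.lab X) (F.lab S) (F.lab (insert e T))) := by
    unfold nested
    rw [← sum_add_distrib, ← sum_add_distrib, ← sum_add_distrib, ← sum_add_distrib, ← sum_add_distrib, ← sum_add_distrib,
      ← sum_add_distrib, ← sum_add_distrib, ← sum_add_distrib]
    refine sum_le_sum fun X hX => ?_
    rw [← sum_add_distrib, ← sum_add_distrib, ← sum_add_distrib, ← sum_add_distrib, ← sum_add_distrib, ← sum_add_distrib,
      ← sum_add_distrib, ← sum_add_distrib, ← sum_add_distrib]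
    refine sum_le_sum fun Y hY => ?_
    have hXW : X ⊆ W := mem_powerset.1 hX
    have hYW : Y ⊆ W \ X := mem_powerset.1 hY
    have hYW' : Y ⊆ W := fun a ha => (mem_sdiff.1 (hYW ha)).1
    have hTW : (W \ X) \ Y ⊆ W := fun a ha => (mem_sdiff.1 (mem_sdiff.1 ha).1).1
    exact nbIneqK _ _ _ _ _ _ (F.lab_mono (subset_insert e X)) (F.lab_mono (subset_insert e Y))
      (F.lab_mono (subset_insert e ((W \ X) \ Y))) (hnb X hXW) (hnb Y hYW') (hnb _ hTW)
  linarith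

/-- The hypothesis holds as soon as the singleton `{e}` is not a bottom set. [this work] -/
theorem upper_ne_zero_of_lab_singleton_ne_zero (e : α) (hv : F.lab {e} ≠ 0) (X : Finset α) : F.lab (insert e X) ≠ 0 := by
  intro h0
  have hm := F.lab_mono (show ({e} : Finset α) ⊆ insert e X from singleton_subset_iff.2 (mem_insert_self e X))
  rcases hm with h | h | h
  · exact hv (h.trans h0)
  · exact hv h
  · rw [h0] at h
    exact absurd h.symm (Fin.last_pos'.ne')

/-- **(MZₖ) WITH CONTRACTION at a non-bottom singleton**, nested form. [this work] -/
theorem nested_add_nested_insert_le_of_lab_singleton_ne_zero (W : Finset α) (e : α) (he : e ∉ W) (hv : F.lab {e} ≠ 0) :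
    nested W (fun X Y Z => s6K k (F.lab X) (F.lab Y) (F.lab Z))
      + nested W (fun X Y Z => s6K k (F.lab (insert e X)) (F.lab (insert e Y)) (F.lab (insert e Z)))
      ≤ nested (insert e W) (fun X Y Z => s6K k (F.lab X) (F.lab Y) (F.lab Z)) :=
  F.nested_add_nested_insert_le_of_upper_ne_zero W e he fun X _ => F.upper_ne_zero_of_lab_singleton_ne_zero e hv X

/-- **At the top cube**: `ZKW (univ ∖ e) + (contraction functional on univ ∖ e) ≤ ZK` when `lab {e} ≠ 0`. [this work] -/
theorem ZKW_erase_add_le_ZK_of_lab_singleton_ne_zero [Fintype α] (e : α) (hv : F.lab {e} ≠ 0) :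
    F.ZKW (univ.erase e)
      + nested (univ.erase e) (fun X Y Z => s6K k (F.lab (insert e X)) (F.lab (insert e Y)) (F.lab (insert e Z)))
      ≤ F.ZK := by
  have h := F.nested_add_nested_insert_le_of_lab_singleton_ne_zero (univ.erase e) e (notMem_erase e univ) hv
  rw [insert_erase (mem_univ e)] at h
  rw [← F.ZKW_univ]
  unfold ZKW
  exact h

end MSunflower

end Summit.CriticalPhenomena.PercolationContinuityZ3.Theorems.SunflowerPartition
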